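import Summits.FinalStateConjecture.FinalStateConjecture.Theorems.EIHFluxBalanceInertialRecessionRechartTransfer

/-!
# Route EIHFluxBalance — `InertialRecession`, re-charting: the ZONE LEMMA (exhaustion curves
# reach the tilted slabs without a loitering clause)

Helper file for the crux `stmt-FinalStateConjecture-10166`
(`Summit.FinalStateConjecture.FinalStateConjecture.Theses.EIHFluxBalance.InertialRecession`),
stub `stub_rechart` of line `sublinear-is-free-clean-window-charges`.

`…RechartTransfer` proved `O ⊆ certified-late(τ₁) ∪ J⁻(certified slab(τ₁))` from a HOVER
hypothesis (every hole-chart point with hole time `≤ τ₁` reaches the tilted slab `{t* = τ₁}`),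
which `…RechartHoleCausal` supplied from certified static orbits above radius `r₊ + δ` and a
LOITERING clause (Hov) below. This file removes (Hov): the layer `(r₊, r₊ + δ)` is handled by
EXHAUSTION plus EVENTUAL LAB-TIME CAUSALITY of the chart (the registered hypothesis of
`stub_rechart`):

* `exists_isFutureCausalCurveOn_of_mem_causalPast` — a point of `J⁻(S) ∖ S` is joined to `S` by a
  future causal curve (read the witnessing curve backwards).
* `exists_late_preimage_of_mem_causalFuture` — **futures of late chart points stay in the late
  chart image**: if `z ∈ O ∩ J⁺(Φ x)` with `x` late and outside the painted horizons, then
  `z = Φ x'` with `x'` late, outside the painted horizons and `x⁰ ≤ x'⁰` (else exhaustion at a lab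
  time `t₁ < x⁰` joins `z`, hence `Φ x`, causally to the lab slab `t₁`, against lab-time causality).
* `mem_causalPast_slab_of_zone` — **the zone lemma**: a future causal curve of late chart points
  starting at a hole-chart point `ψᵢ y₁` with `t*(y₁) ≤ τ₁`, `r(y₁) < Rz`, and ending at a point whose
  hole time is `≥ τ₁` if it is still within radius `Rz`, passes through the slab `{t* = τ₁, r ≤ R(τ₁)}`
  or exits the zone `{r < Rz}` at a CERTIFIED point (radius `Rz ≥ r₊ + δ`, hole time `< τ₁`) which a
  static orbit carries to the slab: first exit parameter (`sInf` of a closed set), intermediate values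
  of the painted radius and of the hole time along the curve read through the open embeddings
  `Φ`, `ψᵢ` (`exists_mem_Icc_apply_eq_of_curve`).
The transfer itself (`exterior_subset_certified_union_causalPast₂`) is in `…RechartTransfer2`.

[O'Neill 1983, Ch. 14, pp. 402–404; folklore causal bookkeeping]
-/

noncomputable section

set_option linter.dupNamespace false

open Set Filter Topology Function TopologicalSpace Literature.Geometry.Lorentzian
open scoped Manifold ContDiff

namespace Summit.FinalStateConjecture.FinalStateConjecture.Theorems

/-! ### A causal curve out of `J⁻` -/

section Curve

variable {E : Type*} [NormedAddCommGroup E] [NormedSpace ℝ E] {H : Type*} [TopologicalSpace H]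
  {I : ModelWithCorners ℝ E H} {n : WithTop ℕ∞} {M : Type*} [TopologicalSpace M]
  [ChartedSpace H M] [IsManifold I ((⊤ : ℕ∞) : WithTop ℕ∞) M]
  {g : LorentzianMetric I n M} {τ : TimeOrientation g}

/-- A point of `J⁻(S)` is in `S` or is the initial point of a future causal curve ending in `S`
(read the witnessing curve of the reversed orientation backwards). O'Neill 1983, Ch. 14, p. 402.
[folklore] -/
theorem exists_isFutureCausalCurveOn_of_mem_causalPast {S : Set M} {p : M}
    (hp : p ∈ g.causalPast τ S) :
    p ∈ S ∨ ∃ (γ : ℝ → M) (a b : ℝ), a < b ∧ g.IsFutureCausalCurveOn τ γ (Icc a b) ∧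
      γ a = p ∧ γ b ∈ S := by
  rcases hp with hp | ⟨q, hq, γ, a, b, hab, hγ, hγa, hγb⟩
  · exact Or.inl hp
  · refine Or.inr ⟨fun t ↦ γ (a + b - t), a, b, hab,
      LorentzianMetric.isFutureCausalCurveOn_reverse_reverse_iff.mp hγ.reverseParam, ?_, ?_⟩
    · show γ (a + b - a) = p
      rw [add_sub_cancel_left]; exact hγb
    · show γ (a + b - b) ∈ S
      rw [add_sub_cancel_right, hγa]; exact hq

/-- Registered one-line form (stub `curve_of_mem_causalPast_rechart` of the crux item) of
`exists_isFutureCausalCurveOn_of_mem_causalPast`. [folklore] -/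
theorem curve_of_mem_causalPast_rechart : open Set in ∀ {E : Type*} [NormedAddCommGroup E] [NormedSpace ℝ E] {H : Type*} [TopologicalSpace H] {I : ModelWithCorners ℝ E H} {n : WithTop ℕ∞} {M : Type*} [TopologicalSpace M] [ChartedSpace H M] [IsManifold I ((⊤ : ℕ∞) : WithTop ℕ∞) M] {g : Literature.Geometry.Lorentzian.LorentzianMetric I n M} {τ : Literature.Geometry.Lorentzian.TimeOrientation g} {S : Set M} {p : M}, p ∈ g.causalPast τ S → p ∈ S ∨ ∃ (γ : ℝ → M) (a b : ℝ), a < b ∧ g.IsFutureCausalCurveOn τ γ (Icc a b) ∧ γ a = p ∧ γ b ∈ S :=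
  fun hp ↦ exists_isFutureCausalCurveOn_of_mem_causalPast hp

end Curve

/-! ### The transfer without loitering -/

section Transfer

variable {𝓢 : Spacetime 4} {N : ℕ} (U : Opens E4) (Φ : U → 𝓢.carrier) (O : Set 𝓢.carrier)
  (Pext : U → Prop) (rp : Fin N → U → ℝ) (rH δ Rz : Fin N → ℝ)
  (Kb : Fin N → ModelBackground) (ψ : ∀ i, (Kb i).domain → 𝓢.carrier)
  (R : Fin N → ℝ → ℝ) (hRm : ∀ i, Monotone (R i))
  (U₀ : Opens E4) (hU₀ : U₀ ≤ U) (Rb T₂ : ℝ → ℝ) (α β : Fin N → ℝ) {τ₀ τ₀' τT Tc S : ℝ}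
  (hτ : τ₀ < τ₀') (hτT : τT < τ₀') (hTc : Tc ≤ τ₀') (hβ : ∀ i, 0 ≤ β i) (hα : ∀ i, 0 < α i)
  -- exhaustion (vii), lab-time causality, `O` below the late image
  (hexh : ∀ t₁ : ℝ, τ₀ < t₁ → O \ Φ '' {x : U | t₁ < x.1 0 ∧ Pext x} ⊆
    𝓢.metric.causalPast 𝓢.timeOrientation (Φ '' {x : U | x.1 0 = t₁ ∧ Pext x}))
  (hT : ∀ x x' : U, τT < x.1 0 → Pext x → τT < x'.1 0 → Pext x' →
    Φ x' ∈ 𝓢.metric.causalFuture 𝓢.timeOrientation {Φ x} → x.1 0 ≤ x'.1 0)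
  (hOcl : ∀ p ∈ O, ∀ z : 𝓢.carrier, z ∈ 𝓢.metric.causalFuture 𝓢.timeOrientation {p} →
    z ∈ 𝓢.metric.causalPast 𝓢.timeOrientation (Φ '' {x : U | τ₀ < x.1 0 ∧ Pext x}) → z ∈ O)
  (himO : Φ '' {x : U | τ₀ < x.1 0 ∧ Pext x} ⊆ O)
  -- the charts
  (hemb : IsOpenEmbedding (({x : U | τ₀ < x.1 0} : Set U).restrict Φ))
  (hrpc : ∀ i, Continuous (rp i))
  (hψemb : ∀ i, IsOpenEmbedding (ψ i)) (hKt : ∀ i, Continuous (Kb i).time)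
  (hKr : ∀ i, Continuous (Kb i).radius)
  (hlab : ∀ (i : Fin N) (y : (Kb i).domain), ∃ x : U, Φ x = ψ i y ∧ τ₀ < x.1 0 ∧ Pext x ∧
    rp i x = (Kb i).radius y.1)
  (hsplit : ∀ x : U, τ₀' ≤ x.1 0 → Pext x → x.1 ∈ (U₀ : Set E4) ∨ ∃ i, rp i x ≤ Rb (x.1 0))
  (hPext : ∀ (x : U) (i : Fin N), Pext x → rH i < rp i x)
  (hcov : ∀ (i : Fin N) (x : U), Tc ≤ x.1 0 → rH i < rp i x → rp i x ≤ Rb (x.1 0) →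
    ∃ y : (Kb i).domain, ψ i y = Φ x ∧ (Kb i).radius y.1 = rp i x ∧
      |(Kb i).time y.1 - α i * x.1 0| ≤ β i * rp i x)
  (hRz : ∀ (i : Fin N) (t : ℝ), τ₀' ≤ t → Rz i ≤ Rb t) (hδRz : ∀ i, rH i + δ i ≤ Rz i)
  (hT₂ : ∀ (i : Fin N) (τ₁ : ℝ), (τ₁ + β i * Rz i) / α i ≤ T₂ τ₁ ∧ τ₁ ≤ T₂ τ₁)
  -- certified static flow, meshing
  (hstat : ∀ (i : Fin N) (y : (Kb i).domain) (τ₁ : ℝ), τ₀' ≤ τ₁ → S ≤ (Kb i).time y.1 →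
    (Kb i).time y.1 ≤ τ₁ → rH i + δ i ≤ (Kb i).radius y.1 →
    (Kb i).radius y.1 ≤ R i ((Kb i).time y.1) →
      ψ i y ∈ 𝓢.metric.causalPast 𝓢.timeOrientation (ψ i '' (Kb i).truncTimeSlab (R i τ₁) τ₁))
  (hmesh : ∀ (i : Fin N) (t : ℝ), τ₀' ≤ t → S ≤ α i * t - β i * Rb t ∧
    Rb t ≤ R i (α i * t - β i * Rb t) ∧ α i * t + β i * Rb t ≤ t)
  (hzone : ∀ (i : Fin N) (t : ℝ), τ₀' ≤ t → S ≤ α i * t - β i * Rz i ∧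
    Rz i ≤ R i (α i * t - β i * Rz i) ∧ Rz i ≤ R i t)

include hτ hτT hexh hT in
/-- **Futures of late chart points stay in the late chart image.** If `x` is a late lab point
outside the painted horizons and `z ∈ O ∩ J⁺(Φ x)`, then `z = Φ x'` with `x'` late, outside the
painted horizons and `x⁰ ≤ x'⁰`: otherwise exhaustion at a lab time `t₁ ∈ (max τ₀ τT, x⁰)` joins
`z` — hence `Φ x` — causally to the lab slab `t₁`, against lab-time causality. [folklore] -/
theorem exists_late_preimage_of_mem_causalFuture (x : U) (hx : τ₀' ≤ x.1 0) (hxP : Pext x)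
    {z : 𝓢.carrier} (hzO : z ∈ O)
    (hz : z ∈ 𝓢.metric.causalFuture 𝓢.timeOrientation {Φ x}) :
    ∃ x' : U, Φ x' = z ∧ τ₀ < x'.1 0 ∧ Pext x' ∧ x.1 0 ≤ x'.1 0 := by
  set t₁ : ℝ := (max τ₀ τT + x.1 0) / 2 with ht₁
  have hm : max τ₀ τT < x.1 0 := (max_lt hτ hτT).trans_le hx
  have ht₁0 : τ₀ < t₁ := by rw [ht₁]; linarith [le_max_left τ₀ τT]
  have ht₁T : τT < t₁ := by rw [ht₁]; linarith [le_max_right τ₀ τT]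
  have ht₁x : t₁ < x.1 0 := by rw [ht₁]; linarith
  have hxT : τT < x.1 0 := hτT.trans_le hx
  by_cases hzE : z ∈ Φ '' {x' : U | t₁ < x'.1 0 ∧ Pext x'}
  · obtain ⟨x', ⟨h1, h2⟩, rfl⟩ := hzE
    exact ⟨x', rfl, ht₁0.trans h1, h2, hT x x' hxT hxP (ht₁T.trans h1) h2 hz⟩
  · exfalso
    have hJ := hexh t₁ ht₁0 ⟨hzO, hzE⟩
    rw [mem_causalPast_iff_exists_mem] at hJ
    obtain ⟨_, ⟨y, ⟨hy0, hyP⟩, rfl⟩, hzy⟩ := hJ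
    have hyz : Φ y ∈ 𝓢.metric.causalFuture 𝓢.timeOrientation {z} :=
      LorentzianMetric.mem_causalPast_singleton_iff.mp hzy
    have hyx : Φ y ∈ 𝓢.metric.causalFuture 𝓢.timeOrientation {Φ x} := by
      rw [← LorentzianMetric.causalFuture_causalFuture_eq
        (WithTop.coe_le_coe.mpr le_top : (2 : ℕ∞ω) ≤ ∞) {Φ x}]
      exact LorentzianMetric.causalFuture_mono (singleton_subset_iff.mpr hz) hyz
    have := hT x y hxT hxP (by rw [hy0]; exact ht₁T) hyP hyx
    rw [hy0] at this
    linarith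

include hτ hτT hexh hT hOcl in
/-- **Points of an exhaustion curve are late chart points.** A future causal curve from the late
chart point `Φ x ∈ O` (outside the painted horizons) whose endpoint lies in the late image
consists of points `Φ x'` with `x'` late, outside the painted horizons and `x⁰ ≤ x'⁰`. [folklore] -/
theorem exists_late_preimage_of_curve (x : U) (hx : τ₀' ≤ x.1 0) (hxP : Pext x)
    (hxO : Φ x ∈ O) {γ : ℝ → 𝓢.carrier} {a b : ℝ}
    (hγ : 𝓢.metric.IsFutureCausalCurveOn 𝓢.timeOrientation γ (Icc a b)) (hγa : γ a = Φ x)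
    (hγb : γ b ∈ Φ '' {x' : U | τ₀ < x'.1 0 ∧ Pext x'}) {s : ℝ} (hs : s ∈ Icc a b) :
    ∃ x' : U, Φ x' = γ s ∧ τ₀ < x'.1 0 ∧ Pext x' ∧ x.1 0 ≤ x'.1 0 := by
  have h1 : γ s ∈ 𝓢.metric.causalFuture 𝓢.timeOrientation {Φ x} := by
    rw [← hγa]; exact hγ.apply_mem_causalFuture_apply_left hs
  have h2 : γ s ∈ 𝓢.metric.causalPast 𝓢.timeOrientation
      (Φ '' {x' : U | τ₀ < x'.1 0 ∧ Pext x'}) :=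
    mem_causalPast_of_curve (hγ.mono (Icc_subset_Icc hs.1 le_rfl)) ⟨hs.2, le_rfl⟩ hγb
  exact exists_late_preimage_of_mem_causalFuture U Φ O Pext hτ hτT hexh hT x hx hxP
    (hOcl _ hxO _ h1 h2) h1

include hRm hTc hemb hrpc hψemb hKt hKr hlab hPext hcov hRz hδRz hstat hzone in
/-- **The zone lemma.** Let `γ` be a future causal curve on `[a, b]` of late chart points with lab
time `≥ τ₁`, starting at a hole-chart point `ψᵢ y₁` with `t*(y₁) ≤ τ₁` and `r(y₁) < Rzᵢ`, whose
endpoint has hole time `≥ τ₁` if it is still within radius `Rzᵢ` of hole `i`. Then `γ a` lies in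
`J⁻` of the slab `ψᵢ{t* = τ₁, r ≤ Rᵢ(τ₁)}`: either the hole time `τ₁` is taken along the curve
inside the zone `{r < Rzᵢ}` (intermediate values through `ψᵢ`), or the curve first leaves the zone
(`sInf` of the closed exit set) at a point of painted radius exactly `Rzᵢ` (intermediate values of
the painted radius through `Φ`, and coverage), which is certified (`Rzᵢ ≥ r₊ + δ`) with hole time
`< τ₁`, so that the static flow carries it to the slab. [folklore] -/
theorem mem_causalPast_slab_of_zone (i : Fin N) (τ₁ : ℝ) (hτ₁ : τ₀' ≤ τ₁)
    {γ : ℝ → 𝓢.carrier} {a b : ℝ} (hab : a ≤ b)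
    (hγ : 𝓢.metric.IsFutureCausalCurveOn 𝓢.timeOrientation γ (Icc a b))
    (hlate : ∀ s ∈ Icc a b, ∃ x : U, Φ x = γ s ∧ τ₀ < x.1 0 ∧ Pext x ∧ τ₁ ≤ x.1 0)
    (y₁ : (Kb i).domain) (hy₁ : ψ i y₁ = γ a) (hy₁t : (Kb i).time y₁.1 ≤ τ₁)
    (hy₁r : (Kb i).radius y₁.1 < Rz i)
    (hend : ∀ y : (Kb i).domain, ψ i y = γ b → (Kb i).radius y.1 < Rz i →
      τ₁ ≤ (Kb i).time y.1) :
    γ a ∈ 𝓢.metric.causalPast 𝓢.timeOrientation (ψ i '' (Kb i).truncTimeSlab (R i τ₁) τ₁) := by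
  set slab : Set 𝓢.carrier := ψ i '' (Kb i).truncTimeSlab (R i τ₁) τ₁ with hslab
  set W : Set 𝓢.carrier := ψ i '' {y | (Kb i).radius y.1 < Rz i} with hW
  have hWo : IsOpen W :=
    (hψemb i).isOpenMap _ (isOpen_lt ((hKr i).comp continuous_subtype_val) continuous_const)
  have hγc : ContinuousOn γ (Icc a b) := continuousOn_of_isFutureCausalCurveOn hγ
  -- injectivity of the lab chart on the late region
  have hinj : ∀ x x' : U, τ₀ < x.1 0 → τ₀ < x'.1 0 → Φ x = Φ x' → x = x' := by
    intro x x' hx hx' h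
    have := hemb.injective
      (show ({x : U | τ₀ < x.1 0} : Set U).restrict Φ ⟨x, hx⟩ =
        ({x : U | τ₀ < x.1 0} : Set U).restrict Φ ⟨x', hx'⟩ from h)
    exact congrArg Subtype.val this
  -- painted radius of zone points
  have hWrad : ∀ (s : ℝ) (x : U), τ₀ < x.1 0 → Φ x = γ s → γ s ∈ W → rp i x < Rz i := by
    rintro s x hx hxs ⟨y, hy, hys⟩
    obtain ⟨x', hx'ψ, hx'0, -, hx'r⟩ := hlab i y
    have : x' = x := hinj x' x hx'0 hx (by rw [hx'ψ, hys, hxs])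
    rw [← this, hx'r]; exact hy
  have hconcl : ∀ s ∈ Icc a b, γ s ∈ slab →
      γ a ∈ 𝓢.metric.causalPast 𝓢.timeOrientation slab := fun s hs h ↦
    mem_causalPast_of_curve hγ hs h
  -- the exit set
  set B : Set ℝ := Icc a b ∩ γ ⁻¹' Wᶜ with hB
  have hBc : IsClosed B := hγc.preimage_isClosed_of_isClosed isClosed_Icc hWo.isClosed_compl
  have haW : γ a ∈ W := ⟨y₁, hy₁r, hy₁⟩
  by_cases hBne : B.Nonempty
  · -- EXIT: the curve leaves the zone, first at `σ₂`
    set σ₂ : ℝ := sInf B with hσ₂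
    have hbdd : BddBelow B := ⟨a, fun s hs ↦ hs.1.1⟩
    have hσ₂B : σ₂ ∈ B := hBc.csInf_mem hBne hbdd
    have hσ₂I : σ₂ ∈ Icc a b := hσ₂B.1
    have hσ₂W : γ σ₂ ∉ W := hσ₂B.2
    have hbefore : ∀ s, a ≤ s → s < σ₂ → γ s ∈ W := fun s has hs ↦ by
      by_contra h
      have : σ₂ ≤ s := csInf_le hbdd ⟨⟨has, hs.le.trans hσ₂I.2⟩, h⟩
      linarith
    have haσ₂ : a < σ₂ := lt_of_le_of_ne hσ₂I.1 fun h ↦ hσ₂W (h ▸ haW)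
    obtain ⟨x₂, hx₂, hx₂0, hx₂P, hx₂τ⟩ := hlate σ₂ hσ₂I
    have hx₂τ' : τ₀' ≤ x₂.1 0 := hτ₁.trans hx₂τ
    -- the painted radius at the exit point is exactly `Rz i`
    have hle : rp i x₂ ≤ Rz i := by
      by_contra h
      rw [not_le] at h
      obtain ⟨xa, hxa, hxa0, -, -⟩ := hlate a ⟨le_rfl, hab⟩
      have hxar : rp i xa < Rz i := hWrad a xa hxa0 hxa haW
      have hmaps : MapsTo γ (Icc a σ₂) (range (({x : U | τ₀ < x.1 0} : Set U).restrict Φ)) := by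
        intro s hs
        obtain ⟨x, hx, hx0, -, -⟩ := hlate s ⟨hs.1, hs.2.trans hσ₂I.2⟩
        exact ⟨⟨x, hx0⟩, hx⟩
      obtain ⟨s, hs, ⟨x, hx0⟩, hxs, hxr⟩ := exists_mem_Icc_apply_eq_of_curve hemb haσ₂.le
        (hγc.mono (Icc_subset_Icc le_rfl hσ₂I.2)) hmaps
        (f := fun x : ({x : U | τ₀ < x.1 0} : Set U) ↦ rp i x.1)
        ((hrpc i).comp continuous_subtype_val)
        (xa := ⟨xa, hxa0⟩) (xb := ⟨x₂, hx₂0⟩) hxa hx₂ (c := Rz i) hxar.le h.le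
      rcases eq_or_lt_of_le hs.2 with hsσ | hsσ
      · have : x = x₂ := hinj x x₂ hx0 hx₂0 (hxs.trans (hsσ ▸ hx₂).symm)
        have hxr' : rp i x = Rz i := hxr
        rw [this] at hxr'
        linarith
      · have h1 := hWrad s x hx0 hxs (hbefore s hs.1 hsσ)
        have hxr' : rp i x = Rz i := hxr
        linarith
    have hge : Rz i ≤ rp i x₂ := by
      by_contra h
      rw [not_le] at h
      obtain ⟨y, hyψ, hyr, -⟩ := hcov i x₂ (hTc.trans hx₂τ') (hPext x₂ i hx₂P)
        (h.le.trans (hRz i _ hx₂τ'))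
      exact hσ₂W ⟨y, by rw [mem_setOf_eq, hyr]; exact h, hyψ.trans hx₂⟩
    obtain ⟨y₂, hy₂ψ, hy₂r, hy₂t⟩ := hcov i x₂ (hTc.trans hx₂τ') (hPext x₂ i hx₂P)
      (hle.trans (hRz i _ hx₂τ'))
    have hx₂r : rp i x₂ = Rz i := le_antisymm hle hge
    rw [hx₂r] at hy₂r hy₂t
    have hy₂γ : ψ i y₂ = γ σ₂ := hy₂ψ.trans hx₂
    -- up to `σ₂` the curve runs in the image of `ψ i`
    have hmapsψ : MapsTo γ (Icc a σ₂) (range (ψ i)) := by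
      intro s hs
      rcases eq_or_lt_of_le hs.2 with h | h
      · rw [h, ← hy₂γ]; exact mem_range_self _
      · obtain ⟨y, -, hy⟩ := hbefore s hs.1 h
        exact ⟨y, hy⟩
    obtain ⟨hS, hRzR, -⟩ := hzone i (x₂.1 0) hx₂τ'
    obtain ⟨-, -, hRzτ⟩ := hzone i τ₁ hτ₁
    rcases le_or_gt τ₁ ((Kb i).time y₂.1) with ht | ht
    · -- the hole time `τ₁` is taken on `[a, σ₂]`
      obtain ⟨s, hs, y, hys, hyt⟩ := exists_mem_Icc_apply_eq_of_curve (hψemb i) haσ₂.le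
        (hγc.mono (Icc_subset_Icc le_rfl hσ₂I.2)) hmapsψ
        (f := fun y : (Kb i).domain ↦ (Kb i).time y.1) ((hKt i).comp continuous_subtype_val)
        (xa := y₁) (xb := y₂) hy₁ hy₂γ hy₁t ht
      have hyr : (Kb i).radius y.1 ≤ Rz i := by
        rcases eq_or_lt_of_le hs.2 with h | h
        · have : y = y₂ := (hψemb i).injective (hys.trans (h ▸ hy₂γ.symm))
          rw [this, hy₂r]
        · obtain ⟨y', hy'r, hy'⟩ := hbefore s hs.1 h
          have : y' = y := (hψemb i).injective (hy'.trans hys.symm)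
          rw [← this]; exact le_of_lt hy'r
      refine hconcl s ⟨hs.1, hs.2.trans hσ₂I.2⟩ ⟨y, ?_, hys⟩
      rw [ModelBackground.mem_truncTimeSlab]
      exact ⟨hyt, hyr.trans hRzτ⟩
    · -- exit at a certified point with hole time `< τ₁`: static flow to the slab
      have ht1 : α i * x₂.1 0 - β i * Rz i ≤ (Kb i).time y₂.1 := by
        have := (abs_le.mp hy₂t).1; linarith
      have hy₂J := hstat i y₂ τ₁ hτ₁ (hS.trans ht1) ht.le (by rw [hy₂r]; exact hδRz i)
        (by rw [hy₂r]; exact hRzR.trans (hRm i ht1))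
      rw [hy₂γ] at hy₂J
      exact mem_causalPast_of_subset_causalPast
        (WithTop.coe_le_coe.mpr le_top : (2 : ℕ∞ω) ≤ ∞)
        (mem_causalPast_singleton_of_curve hγ hσ₂I) (singleton_subset_iff.mpr hy₂J)
  · -- WHOLE: the curve never leaves the zone
    have hallW : ∀ s ∈ Icc a b, γ s ∈ W := fun s hs ↦ by
      by_contra h
      exact hBne ⟨s, hs, h⟩
    obtain ⟨yb, hybr, hyb⟩ := hallW b ⟨hab, le_rfl⟩
    have hybt : τ₁ ≤ (Kb i).time yb.1 := hend yb hyb hybr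
    have hmapsψ : MapsTo γ (Icc a b) (range (ψ i)) := fun s hs ↦ by
      obtain ⟨y, -, hy⟩ := hallW s hs
      exact ⟨y, hy⟩
    obtain ⟨s, hs, y, hys, hyt⟩ := exists_mem_Icc_apply_eq_of_curve (hψemb i) hab hγc hmapsψ
      (f := fun y : (Kb i).domain ↦ (Kb i).time y.1) ((hKt i).comp continuous_subtype_val)
      (xa := y₁) (xb := yb) hy₁ hyb hy₁t hybt
    obtain ⟨y', hy'r, hy'⟩ := hallW s hs
    have hyy : y' = y := (hψemb i).injective (hy'.trans hys.symm)
    obtain ⟨-, -, hRzτ⟩ := hzone i τ₁ hτ₁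
    refine hconcl s hs ⟨y, ?_, hys⟩
    rw [ModelBackground.mem_truncTimeSlab]
    exact ⟨hyt, (hyy ▸ hy'r).le.trans hRzτ⟩

end Transfer

end Summit.FinalStateConjecture.FinalStateConjecture.Theorems
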